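import Mathlib

/-!
# Comonotone petals merge favourably (Chebyshev–Harris on four atoms), every number of petals

A normalised multi-coin petal value `V_j = w₀ + w₁u¹_j + w₂u²_j + w₃u³_j` (`w_i ≥ 0`, `∑ w_i = 1`, usages `uⁱ_j ≥ 1`) is the
expectation `E[f_j(U)]` of the function `f_j = (1, u¹_j, u²_j, u³_j)` on a four-atom probability space with weights
`(w₀,w₁,w₂,w₃)`; the MERGED value `w₀ + w₁∏u¹_j + w₂∏u²_j + w₃∏u³_j` is `E[∏_j f_j(U)]` (one common `U`), while `∏_j V_j` is
`E[∏ f_j(U_j)]` with independent `U_j`.  If all petals are COMONOTONE — `1 ≤ u¹_j ≤ u²_j ≤ u³_j` for every `j` (the same order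
of the coins in every petal) — then the products `∏_{j∈T} f_j` stay comonotone and Chebyshev's association inequality
`E[FG] ≥ E[F]E[G]` (here: the explicit identity `E[FG] − E[F]E[G] = Σ_{i<i'} w_iw_{i'}(F_i − F_{i'})(G_i − G_{i'}) ≥ 0`) gives, by
induction on the family,
`∏_j (w₀ + w₁u¹_j + w₂u²_j + w₃u³_j) ≤ w₀ + w₁∏u¹_j + w₂∏u²_j + w₃∏u³_j`   (`comonotone_merge_prod`).
In the (RES0′) sunflower model (prove-1 g54 memo §7(g)(xii)) this is the additive three-coin bound
`∏V_j ≤ 1 + ε_Y(X−1) + ε_g(K−1) + ε_h(R−1) = Φ_K` for every family whose petals all satisfy `1 ≤ r_j ≤ k̂_j ≤ x_j` (full petals,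
x-hubs, Ȳ-rich dwarfs …) or all satisfy another fixed order of the three usages — with NO cover/tying hypothesis; the cover
condition of CONJECTURE H_K is what replaces comonotonicity for mixed families (k-hubs have `x < k̂`).  [this work]
-/

namespace Summit.CriticalPhenomena.PercolationContinuityZ3.Theorems.SunflowerPartition.SafeCalc.LinkedCurrency

open Finset

/-- **Chebyshev step on four atoms.**  For weights `w_i ≥ 0` with `w₀+w₁+w₂+w₃ = 1` and two comonotone vectors
`1 ≤ A₁ ≤ A₂ ≤ A₃`, `1 ≤ b₁ ≤ b₂ ≤ b₃`:
`(w₀ + w₁A₁ + w₂A₂ + w₃A₃)(w₀ + w₁b₁ + w₂b₂ + w₃b₃) ≤ w₀ + w₁A₁b₁ + w₂A₂b₂ + w₃A₃b₃`. [this work] -/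
theorem chebyshev_four_atoms {w₀ w₁ w₂ w₃ A₁ A₂ A₃ b₁ b₂ b₃ : ℝ} (hw0 : 0 ≤ w₀) (hw1 : 0 ≤ w₁) (hw2 : 0 ≤ w₂) (hw3 : 0 ≤ w₃)
    (hsum : w₀ + w₁ + w₂ + w₃ = 1) (hA1 : 1 ≤ A₁) (hA12 : A₁ ≤ A₂) (hA23 : A₂ ≤ A₃) (hb1 : 1 ≤ b₁) (hb12 : b₁ ≤ b₂) (hb23 : b₂ ≤ b₃) :
    (w₀ + w₁ * A₁ + w₂ * A₂ + w₃ * A₃) * (w₀ + w₁ * b₁ + w₂ * b₂ + w₃ * b₃) ≤ w₀ + w₁ * (A₁ * b₁) + w₂ * (A₂ * b₂) + w₃ * (A₃ * b₃) := by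
  -- E[FG] − E[F]E[G] = Σ_{i<i'} w_i w_{i'} (F_i − F_{i'})(G_i − G_{i'}) with F = (1,A₁,A₂,A₃), G = (1,b₁,b₂,b₃)
  have key : (w₀ + w₁ * (A₁ * b₁) + w₂ * (A₂ * b₂) + w₃ * (A₃ * b₃)) * (w₀ + w₁ + w₂ + w₃) -
      (w₀ + w₁ * A₁ + w₂ * A₂ + w₃ * A₃) * (w₀ + w₁ * b₁ + w₂ * b₂ + w₃ * b₃) =
      w₀ * w₁ * ((A₁ - 1) * (b₁ - 1)) + w₀ * w₂ * ((A₂ - 1) * (b₂ - 1)) + w₀ * w₃ * ((A₃ - 1) * (b₃ - 1)) +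
      w₁ * w₂ * ((A₂ - A₁) * (b₂ - b₁)) + w₁ * w₃ * ((A₃ - A₁) * (b₃ - b₁)) + w₂ * w₃ * ((A₃ - A₂) * (b₃ - b₂)) := by ring
  rw [hsum, mul_one] at key
  have t1 : 0 ≤ w₀ * w₁ * ((A₁ - 1) * (b₁ - 1)) := mul_nonneg (mul_nonneg hw0 hw1) (mul_nonneg (by linarith) (by linarith))
  have t2 : 0 ≤ w₀ * w₂ * ((A₂ - 1) * (b₂ - 1)) := mul_nonneg (mul_nonneg hw0 hw2) (mul_nonneg (by linarith) (by linarith))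
  have t3 : 0 ≤ w₀ * w₃ * ((A₃ - 1) * (b₃ - 1)) := mul_nonneg (mul_nonneg hw0 hw3) (mul_nonneg (by linarith) (by linarith))
  have t4 : 0 ≤ w₁ * w₂ * ((A₂ - A₁) * (b₂ - b₁)) := mul_nonneg (mul_nonneg hw1 hw2) (mul_nonneg (by linarith) (by linarith))
  have t5 : 0 ≤ w₁ * w₃ * ((A₃ - A₁) * (b₃ - b₁)) := mul_nonneg (mul_nonneg hw1 hw3) (mul_nonneg (by linarith) (by linarith))
  have t6 : 0 ≤ w₂ * w₃ * ((A₃ - A₂) * (b₃ - b₂)) := mul_nonneg (mul_nonneg hw2 hw3) (mul_nonneg (by linarith) (by linarith))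
  linarith

/-- **COMONOTONE PETALS MERGE FAVOURABLY (all `n`).**  Weights `w_i ≥ 0`, `w₀+w₁+w₂+w₃ = 1`; a finite family of petals with
usages `1 ≤ u¹_j ≤ u²_j ≤ u³_j` (the same coin order in every petal).  Then
`∏_{j∈S} (w₀ + w₁u¹_j + w₂u²_j + w₃u³_j) ≤ w₀ + w₁∏_{j∈S}u¹_j + w₂∏_{j∈S}u²_j + w₃∏_{j∈S}u³_j`.
(In the sunflower model with `(u¹,u²,u³) = (r, k̂, x)`: `∏V_j ≤ Φ_K = 1 + ε_Y(X−1) + ε_g(K−1) + ε_h(R−1)` for every family of petals with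
`r_j ≤ k̂_j ≤ x_j`, every `n`, no budget and no cover hypothesis.) [this work] -/
theorem comonotone_merge_prod {ι : Type*} (S : Finset ι) {w₀ w₁ w₂ w₃ : ℝ} (hw0 : 0 ≤ w₀) (hw1 : 0 ≤ w₁) (hw2 : 0 ≤ w₂)
    (hw3 : 0 ≤ w₃) (hsum : w₀ + w₁ + w₂ + w₃ = 1) (u₁ u₂ u₃ : ι → ℝ)
    (h1 : ∀ j ∈ S, 1 ≤ u₁ j) (h12 : ∀ j ∈ S, u₁ j ≤ u₂ j) (h23 : ∀ j ∈ S, u₂ j ≤ u₃ j) :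
    ∏ j ∈ S, (w₀ + w₁ * u₁ j + w₂ * u₂ j + w₃ * u₃ j) ≤
      w₀ + w₁ * ∏ j ∈ S, u₁ j + w₂ * ∏ j ∈ S, u₂ j + w₃ * ∏ j ∈ S, u₃ j := by
  classical
  induction S using Finset.induction_on with
  | empty => simp; linarith
  | @insert i T hi ih =>
    have h1T : ∀ j ∈ T, 1 ≤ u₁ j := fun j hj => h1 j (mem_insert_of_mem hj)
    have h12T : ∀ j ∈ T, u₁ j ≤ u₂ j := fun j hj => h12 j (mem_insert_of_mem hj)
    have h23T : ∀ j ∈ T, u₂ j ≤ u₃ j := fun j hj => h23 j (mem_insert_of_mem hj)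
    have ihT := ih h1T h12T h23T
    -- the merged usages of T are again comonotone and ≥ 1
    have P1 : 1 ≤ ∏ j ∈ T, u₁ j := by
      have : ∏ j ∈ T, (1:ℝ) ≤ ∏ j ∈ T, u₁ j := prod_le_prod (fun _ _ => zero_le_one) (fun j hj => h1T j hj)
      simpa using this
    have P12 : ∏ j ∈ T, u₁ j ≤ ∏ j ∈ T, u₂ j :=
      prod_le_prod (fun j hj => zero_le_one.trans (h1T j hj)) (fun j hj => h12T j hj)
    have P23 : ∏ j ∈ T, u₂ j ≤ ∏ j ∈ T, u₃ j :=
      prod_le_prod (fun j hj => (zero_le_one.trans (h1T j hj)).trans (h12T j hj)) (fun j hj => h23T j hj)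
    have hi1 : 1 ≤ u₁ i := h1 i (mem_insert_self i T)
    have hi12 : u₁ i ≤ u₂ i := h12 i (mem_insert_self i T)
    have hi23 : u₂ i ≤ u₃ i := h23 i (mem_insert_self i T)
    rw [prod_insert hi, prod_insert hi, prod_insert hi, prod_insert hi]
    -- value of the new petal is ≥ 0
    have hVi : 0 ≤ w₀ + w₁ * u₁ i + w₂ * u₂ i + w₃ * u₃ i := by
      nlinarith [mul_nonneg hw1 (zero_le_one.trans hi1), mul_nonneg hw2 ((zero_le_one.trans hi1).trans hi12),
        mul_nonneg hw3 (((zero_le_one.trans hi1).trans hi12).trans hi23)]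
    calc (w₀ + w₁ * u₁ i + w₂ * u₂ i + w₃ * u₃ i) * ∏ j ∈ T, (w₀ + w₁ * u₁ j + w₂ * u₂ j + w₃ * u₃ j)
        ≤ (w₀ + w₁ * u₁ i + w₂ * u₂ i + w₃ * u₃ i) *
            (w₀ + w₁ * ∏ j ∈ T, u₁ j + w₂ * ∏ j ∈ T, u₂ j + w₃ * ∏ j ∈ T, u₃ j) :=
          mul_le_mul_of_nonneg_left ihT hVi
      _ = (w₀ + w₁ * ∏ j ∈ T, u₁ j + w₂ * ∏ j ∈ T, u₂ j + w₃ * ∏ j ∈ T, u₃ j) *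
            (w₀ + w₁ * u₁ i + w₂ * u₂ i + w₃ * u₃ i) := by ring
      _ ≤ w₀ + w₁ * ((∏ j ∈ T, u₁ j) * u₁ i) + w₂ * ((∏ j ∈ T, u₂ j) * u₂ i) + w₃ * ((∏ j ∈ T, u₃ j) * u₃ i) :=
          chebyshev_four_atoms hw0 hw1 hw2 hw3 hsum P1 P12 P23 hi1 hi12 hi23
      _ = w₀ + w₁ * (u₁ i * ∏ j ∈ T, u₁ j) + w₂ * (u₂ i * ∏ j ∈ T, u₂ j) + w₃ * (u₃ i * ∏ j ∈ T, u₃ j) := by ring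

set_option maxHeartbeats 400000 in
/-- **(RES0′) FOR EVERY NUMBER OF PETALS ON THE COMONOTONE CLASS** (model form).  Parameters `τ ∈ (0,1)`, `σ ∈ [0,1)`, `s ∈ [0,1]`,
floors `0 < α₀₀ ≤ α₀₁ ≤ α₁₁`, ANY constant `c₀ ≥ 0` (even the bare HCS constant), `p = τ(1−σ)`, `q = s(1−τ)`,
`b_Ȳ = (1−s)α₀₀ + sα₀₁`, `b_H = (1−σ)α₀₁ + σα₁₁`, `g = c₀ + p b_Ȳ + q b_H`.  Petals `j ∈ S` (`S ≠ ∅`) with `α₀₀ ≤ y_j`,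
`α₀₁ ≤ g_j ≤ k_j`, `α₁₁ ≤ h_j`, which are COMONOTONE: `h_j ≤ k_j` and `α₀₀ k_j ≤ α₀₁ y_j` (h-usage ≤ k-usage ≤ y-usage; full petals,
dwarfs `y=k=g=h`, Ȳ-rich petals …).  Under the three budgets `∏ Ȳ_j ≤ b_Ȳ^(|S|−1)`, `∏ k_j ≤ α₀₁^(|S|−1)`, `∏ h_j ≤ α₁₁^(|S|−1)`:
`∏_j (c₀ + pȲ_j + q((1−σ)g_j + σh_j)) ≤ g^(|S|−1)·(c₀ + p + q)`.  Proof: `G_j ≤ g·(w₀ + w₁r_j + w₂k̂_j + w₃x_j)` with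
`(w₀,w₁,w₂,w₃) = (c₀, qσα₁₁, q(1−σ)α₀₁, p b_Ȳ)/g`, `(r,k̂,x) = (h/α₁₁, k/α₀₁, Ȳ/b_Ȳ)` comonotone, then `comonotone_merge_prod` and the
budgets. [this work] -/
theorem res0_comonotone {κ : Type*} [DecidableEq κ] {τ σ s α00 α01 α11 c0 : ℝ} (hτ0 : 0 < τ) (hτ1 : τ < 1)
    (hσ0 : 0 ≤ σ) (hσ1 : σ < 1) (hs0 : 0 ≤ s) (hs1 : s ≤ 1) (hα00 : 0 < α00) (h01 : α00 ≤ α01) (h11 : α01 ≤ α11) (hc0 : 0 ≤ c0)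
    (S : Finset κ) (hS : S.Nonempty) (y k gc h : κ → ℝ)
    (hy : ∀ j ∈ S, α00 ≤ y j) (hg : ∀ j ∈ S, α01 ≤ gc j) (hgk : ∀ j ∈ S, gc j ≤ k j)
    (hh : ∀ j ∈ S, α11 ≤ h j) (hhk : ∀ j ∈ S, h j ≤ k j) (hyk : ∀ j ∈ S, α00 * k j ≤ α01 * y j)
    (hBY : ∏ j ∈ S, ((1 - s) * y j + s * k j) ≤ ((1 - s) * α00 + s * α01) ^ (S.card - 1))
    (hBk : ∏ j ∈ S, k j ≤ α01 ^ (S.card - 1)) (hBh : ∏ j ∈ S, h j ≤ α11 ^ (S.card - 1)) :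
    ∏ j ∈ S, (c0 + τ * (1 - σ) * ((1 - s) * y j + s * k j) + s * (1 - τ) * ((1 - σ) * gc j + σ * h j)) ≤
      (c0 + τ * (1 - σ) * ((1 - s) * α00 + s * α01) + s * (1 - τ) * ((1 - σ) * α01 + σ * α11)) ^ (S.card - 1) *
        (c0 + τ * (1 - σ) + s * (1 - τ)) := by
  have hα01 : 0 < α01 := lt_of_lt_of_le hα00 h01
  have hα11 : 0 < α11 := lt_of_lt_of_le hα01 h11
  have hp0 : 0 < τ * (1 - σ) := mul_pos hτ0 (by linarith)
  have hpnn : 0 ≤ τ * (1 - σ) := hp0.le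
  have hqnn : 0 ≤ s * (1 - τ) := mul_nonneg hs0 (by linarith)
  have hbY0 : 0 < (1 - s) * α00 + s * α01 := by
    rcases eq_or_lt_of_le hs1 with h | h
    · rw [h]; simpa using hα01
    · nlinarith [mul_pos (sub_pos.2 h) hα00, mul_nonneg hs0 hα01.le]
  have hbH0 : 0 < (1 - σ) * α01 + σ * α11 := by nlinarith [mul_pos (sub_pos.2 hσ1) hα01, mul_nonneg hσ0 hα11.le]
  obtain ⟨bY, hbY⟩ : ∃ b, b = (1 - s) * α00 + s * α01 := ⟨_, rfl⟩
  obtain ⟨bH, hbH⟩ : ∃ b, b = (1 - σ) * α01 + σ * α11 := ⟨_, rfl⟩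
  rw [← hbY] at hBY hbY0 ⊢
  rw [← hbH] at hbH0 ⊢
  obtain ⟨g, hgdef⟩ : ∃ t, t = c0 + τ * (1 - σ) * bY + s * (1 - τ) * bH := ⟨_, rfl⟩
  rw [← hgdef]
  have hgpos : 0 < g := by rw [hgdef]; nlinarith [mul_pos hp0 hbY0, mul_nonneg hqnn hbH0.le]
  obtain ⟨n, hn⟩ : ∃ n, n = S.card := ⟨_, rfl⟩
  have hn1 : 1 ≤ n := by rw [hn]; exact Finset.card_pos.2 hS
  rw [← hn] at hBY hBk hBh ⊢
  have hcardS : S.card = n := hn.symm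
  -- main case g > 0
  obtain ⟨w₀, hw0⟩ : ∃ t, t = c0 / g := ⟨_, rfl⟩
  obtain ⟨w₁, hw1⟩ : ∃ t, t = s * (1 - τ) * σ * α11 / g := ⟨_, rfl⟩
  obtain ⟨w₂, hw2⟩ : ∃ t, t = s * (1 - τ) * (1 - σ) * α01 / g := ⟨_, rfl⟩
  obtain ⟨w₃, hw3⟩ : ∃ t, t = τ * (1 - σ) * bY / g := ⟨_, rfl⟩
  have hw0n : 0 ≤ w₀ := by rw [hw0]; exact div_nonneg hc0 hgpos.le
  have hw1n : 0 ≤ w₁ := by rw [hw1]; positivity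
  have hw2n : 0 ≤ w₂ := by rw [hw2]; exact div_nonneg (mul_nonneg (mul_nonneg hqnn (by linarith)) hα01.le) hgpos.le
  have hw3n : 0 ≤ w₃ := by rw [hw3]; exact div_nonneg (mul_nonneg hpnn hbY0.le) hgpos.le
  have hwsum : w₀ + w₁ + w₂ + w₃ = 1 := by
    rw [hw0, hw1, hw2, hw3]; field_simp; rw [hgdef, hbH]; ring
  -- usages
  have hu1 : ∀ j ∈ S, 1 ≤ h j / α11 := fun j hj => by rw [le_div_iff₀ hα11]; linarith [hh j hj]
  have hu12 : ∀ j ∈ S, h j / α11 ≤ k j / α01 := fun j hj => by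
    rw [div_le_div_iff₀ hα11 hα01]; nlinarith [hhk j hj, h11, hh j hj, hα11]
  have hu23 : ∀ j ∈ S, k j / α01 ≤ ((1 - s) * y j + s * k j) / bY := fun j hj => by
    rw [div_le_div_iff₀ hα01 hbY0, hbY]
    nlinarith [hyk j hj, mul_nonneg (by linarith : (0:ℝ) ≤ 1 - s) (sub_nonneg.2 (hyk j hj))]
  -- G_j ≤ g · W_j
  have hGW : ∀ j ∈ S, c0 + τ * (1 - σ) * ((1 - s) * y j + s * k j) + s * (1 - τ) * ((1 - σ) * gc j + σ * h j) ≤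
      g * (w₀ + w₁ * (h j / α11) + w₂ * (k j / α01) + w₃ * (((1 - s) * y j + s * k j) / bY)) := fun j hj => by
    have e : g * (w₀ + w₁ * (h j / α11) + w₂ * (k j / α01) + w₃ * (((1 - s) * y j + s * k j) / bY)) =
        c0 + τ * (1 - σ) * ((1 - s) * y j + s * k j) + s * (1 - τ) * ((1 - σ) * k j + σ * h j) := by
      rw [hw0, hw1, hw2, hw3]; field_simp; ring
    rw [e]; nlinarith [mul_nonneg (mul_nonneg hqnn (by linarith : (0:ℝ) ≤ 1 - σ)) (sub_nonneg.2 (hgk j hj))]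
  have hGnn : ∀ j ∈ S, 0 ≤ c0 + τ * (1 - σ) * ((1 - s) * y j + s * k j) + s * (1 - τ) * ((1 - σ) * gc j + σ * h j) :=
    fun j hj => by
      have hy0 : 0 ≤ y j := hα00.le.trans (hy j hj)
      have hk0 : 0 ≤ k j := (hα01.le.trans (hg j hj)).trans (hgk j hj)
      have := mul_nonneg hpnn (add_nonneg (mul_nonneg (by linarith : (0:ℝ) ≤ 1 - s) hy0) (mul_nonneg hs0 hk0))
      have := mul_nonneg hqnn (add_nonneg (mul_nonneg (by linarith : (0:ℝ) ≤ 1 - σ) (hα01.le.trans (hg j hj)))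
        (mul_nonneg hσ0 (hα11.le.trans (hh j hj))))
      linarith
  -- products
  have step1 : ∏ j ∈ S, (c0 + τ * (1 - σ) * ((1 - s) * y j + s * k j) + s * (1 - τ) * ((1 - σ) * gc j + σ * h j)) ≤
      ∏ j ∈ S, (g * (w₀ + w₁ * (h j / α11) + w₂ * (k j / α01) + w₃ * (((1 - s) * y j + s * k j) / bY))) :=
    Finset.prod_le_prod hGnn hGW
  have step2 : ∏ j ∈ S, (g * (w₀ + w₁ * (h j / α11) + w₂ * (k j / α01) + w₃ * (((1 - s) * y j + s * k j) / bY))) =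
      g ^ n * ∏ j ∈ S, (w₀ + w₁ * (h j / α11) + w₂ * (k j / α01) + w₃ * (((1 - s) * y j + s * k j) / bY)) := by
    rw [Finset.prod_mul_distrib, Finset.prod_const, hcardS]
  have step3 := comonotone_merge_prod S hw0n hw1n hw2n hw3n hwsum (fun j => h j / α11) (fun j => k j / α01)
    (fun j => ((1 - s) * y j + s * k j) / bY) hu1 hu12 hu23
  -- budgets on the merged usages
  have hpow : ∀ {b : ℝ}, 0 < b → ∀ {U : ℝ}, U ≤ b ^ (n - 1) → U / b ^ n ≤ 1 / b := by
    intro b hb U hU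
    rw [div_le_div_iff₀ (pow_pos hb n) hb]
    have e : b ^ n = b ^ (n - 1) * b := by rw [← pow_succ]; congr 1; omega
    rw [e]
    have := mul_le_mul_of_nonneg_right hU hb.le
    linarith
  have hR : ∏ j ∈ S, h j / α11 ≤ 1 / α11 := by
    rw [Finset.prod_div_distrib, Finset.prod_const, hcardS]; exact hpow hα11 hBh
  have hK : ∏ j ∈ S, k j / α01 ≤ 1 / α01 := by
    rw [Finset.prod_div_distrib, Finset.prod_const, hcardS]; exact hpow hα01 hBk
  have hX : ∏ j ∈ S, ((1 - s) * y j + s * k j) / bY ≤ 1 / bY := by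
    rw [Finset.prod_div_distrib, Finset.prod_const, hcardS]; exact hpow hbY0 hBY
  have step4 : w₀ + w₁ * ∏ j ∈ S, h j / α11 + w₂ * ∏ j ∈ S, k j / α01 + w₃ * ∏ j ∈ S, ((1 - s) * y j + s * k j) / bY ≤
      (c0 + τ * (1 - σ) + s * (1 - τ)) / g := by
    have e : (c0 + τ * (1 - σ) + s * (1 - τ)) / g = w₀ + w₁ * (1 / α11) + w₂ * (1 / α01) + w₃ * (1 / bY) := by
      rw [hw0, hw1, hw2, hw3]; field_simp; ring
    rw [e]
    have := mul_le_mul_of_nonneg_left hR hw1n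
    have := mul_le_mul_of_nonneg_left hK hw2n
    have := mul_le_mul_of_nonneg_left hX hw3n
    linarith
  have hgn : 0 ≤ g ^ n := pow_nonneg hgpos.le n
  calc ∏ j ∈ S, (c0 + τ * (1 - σ) * ((1 - s) * y j + s * k j) + s * (1 - τ) * ((1 - σ) * gc j + σ * h j))
      ≤ g ^ n * ∏ j ∈ S, (w₀ + w₁ * (h j / α11) + w₂ * (k j / α01) + w₃ * (((1 - s) * y j + s * k j) / bY)) := by
        rw [← step2]; exact step1
    _ ≤ g ^ n * ((c0 + τ * (1 - σ) + s * (1 - τ)) / g) := mul_le_mul_of_nonneg_left (step3.trans step4) hgn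
    _ = g ^ (n - 1) * (c0 + τ * (1 - σ) + s * (1 - τ)) := by
        have : g ^ n = g ^ (n - 1) * g := by rw [← pow_succ]; congr 1; omega
        rw [this]; field_simp

end Summit.CriticalPhenomena.PercolationContinuityZ3.Theorems.SunflowerPartition.SafeCalc.LinkedCurrency
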